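import Summits.MatrixMultiplication.OmegaCensus.STPPSmallPatternCriteria

/-!
# ω-census, small STPP pattern `(1,2,2)^k`: the UNIQUE-MATCHED-DIFFERENCES model of engine ε₂ IS Def. 5.1 (kernel criterion)

HONEST FRAMING (pub-omega census; verbatim): lottery ticket; floor = certified bounds/negative ranges.
Census STRUCTURE tool of the STPP track (seat pub-omega ENG1, gen 36; STRUCTURE row B5, the threshold column
`T2(H) = max {k : (1,2,2)^k ⊆ H}`), not progress on `ω`: small patterns in small groups bound no exponent.

ENG1's engine ε₂ (`HOME/code/eng1/jobs/eps2-t2k5win-v1/e1t2b.c`; the complete NONE verdicts for `(1,2,2)⁵` at every abelian type of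
order `38–47`, kit GO #154) does not search Def. 5.1 literally.  With `Aᵢ = {0}` (the tree's per-triple translation) it looks for pairs
`Bᵢ = {bᵢ, b'ᵢ}`, `Cᵢ = {cᵢ, c'ᵢ}` such that the `Bᵢ` are pairwise disjoint, the `Cᵢ` are pairwise disjoint, and every MATCHED
DIFFERENCE `t − u` (`t ∈ Bᵢ`, `u ∈ Cᵢ`, same index) has a UNIQUE representation as a difference `t' − u'` with `t' ∈ ⋃ Bⱼ`,
`u' ∈ ⋃ C_l`.  This file puts into the kernel that this model is EXACTLY the tree's difference model (`exists_isSTPP_122_iff`,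
`STPPSmallPatternCriteria.lean`), hence exactly CKSU Def. 5.1 (tree `IsSTPP`) for the size pattern `(1,2,2)^k` — so that the only
trusted part of the engine is its search:

* `UniqueDiff122 b b' c c'` — the model (a `Prop` on four maps `Fin k → H`);
* `uniqueDiff122_iff_pointPairs` — it is equivalent, for the same four maps, to the right-hand side of `exists_isSTPP_122_iff`;
* `exists_isSTPP_122_iff_uniqueDiff` — **`H` hosts the size pattern `(1,2,2)^k` iff some `b b' c c'` satisfy `UniqueDiff122`**.

No threshold or existence claim is made here.  References: H. Cohn, R. Kleinberg, B. Szegedy, C. Umans, *Group-theoretic algorithms for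
matrix multiplication*, FOCS 2005 (arXiv:math/0511460), Def. 5.1.
-/

namespace Summit.MatrixMultiplication.OmegaCensus

open Finset Literature.Computability.AlgebraicComplexity

variable {H : Type*} [AddCommGroup H] {k : ℕ}

section Model

variable [DecidableEq H]

/-- ENGINE ε₂'s UNIQUE-MATCHED-DIFFERENCES MODEL of a `(1,2,2)^k` family (`Aᵢ = {0}`, `Bᵢ = {bᵢ, b'ᵢ}`, `Cᵢ = {cᵢ, c'ᵢ}`): genuine pairs,
the `Bᵢ` pairwise disjoint, the `Cᵢ` pairwise disjoint, and every matched difference `t − u` (`t ∈ Bᵢ`, `u ∈ Cᵢ`) uniquely represented among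
all differences `t' − u'` (`t' ∈ Bⱼ`, `u' ∈ C_l`). [cite: CohnKleinbergSzegedyUmans2005, Def. 5.1] -/
def UniqueDiff122 (b b' c c' : Fin k → H) : Prop :=
  (∀ i, b i ≠ b' i) ∧ (∀ i, c i ≠ c' i) ∧
    (∀ i j : Fin k, i ≠ j → Disjoint ({b i, b' i} : Finset H) {b j, b' j}) ∧
    (∀ i j : Fin k, i ≠ j → Disjoint ({c i, c' i} : Finset H) {c j, c' j}) ∧
    (∀ i : Fin k, ∀ t ∈ ({b i, b' i} : Finset H), ∀ u ∈ ({c i, c' i} : Finset H), ∀ j l : Fin k,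
      ∀ t' ∈ ({b j, b' j} : Finset H), ∀ u' ∈ ({c l, c' l} : Finset H), t - u = t' - u' → t = t' ∧ u = u')

/-- **Engine ε₂'s model is the tree's `(1,2,2)` difference model** (the right-hand side of `exists_isSTPP_122_iff`, for the same four maps):
within-triple distinctness of the four differences plus the cross condition `t' − u ≠ t − u'` for `(i, l) ≠ (j, j)` ⟺ disjoint `B`'s, disjoint
`C`'s and unique representation of every matched difference. [cite: CohnKleinbergSzegedyUmans2005, Def. 5.1] -/
theorem uniqueDiff122_iff_pointPairs (b b' c c' : Fin k → H) :
    UniqueDiff122 b b' c c' ↔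
      ((∀ i, b i ≠ b' i) ∧ (∀ i, c i ≠ c' i) ∧
        (∀ j : Fin k, ∀ t ∈ ({b j, b' j} : Finset H), ∀ t' ∈ ({b j, b' j} : Finset H),
            ∀ u ∈ ({c j, c' j} : Finset H), ∀ u' ∈ ({c j, c' j} : Finset H), t' - u = t - u' → t = t' ∧ u = u') ∧
        (∀ i j l : Fin k, (i ≠ j ∨ l ≠ j) → ∀ t ∈ ({b i, b' i} : Finset H), ∀ t' ∈ ({b j, b' j} : Finset H),
            ∀ u ∈ ({c j, c' j} : Finset H), ∀ u' ∈ ({c l, c' l} : Finset H), t' - u ≠ t - u')) := by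
  constructor
  · rintro ⟨hb, hc, hDB, hDC, hU⟩
    refine ⟨hb, hc, fun j t ht t' ht' u hu u' hu' e => ?_, fun i j l hijl t ht t' ht' u hu u' hu' e => ?_⟩
    · -- matched difference `t − u'` (index `j`) represented by `(t', u)`
      obtain ⟨h1, h2⟩ := hU j t ht u' hu' j j t' ht' u hu e.symm
      exact ⟨h1, h2.symm⟩
    · -- matched difference `t' − u` (index `j`) represented by `(t, u')`
      obtain ⟨h1, h2⟩ := hU j t' ht' u hu i l t ht u' hu' e
      rcases hijl with hij | hlj
      · exact (disjoint_left.mp (hDB i j hij)) ht (h1 ▸ ht')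
      · exact (disjoint_left.mp (hDC l j hlj)) hu' (h2 ▸ hu)
  · rintro ⟨hb, hc, hW, hX⟩
    refine ⟨hb, hc, fun i j hij => ?_, fun i j hij => ?_, fun i t ht u hu j l t' ht' u' hu' e => ?_⟩
    · rw [disjoint_left]
      intro x hxi hxj
      exact hX i j j (Or.inl hij) x hxi x hxj (c j) (mem_insert_self _ _) (c j) (mem_insert_self _ _) rfl
    · rw [disjoint_left]
      intro x hxi hxj
      exact hX j j i (Or.inr hij) (b j) (mem_insert_self _ _) (b j) (mem_insert_self _ _) x hxj x hxi rfl
    · by_cases hji : j = i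
      · by_cases hli : l = i
        · -- same index three times: within-triple distinctness
          have ht'' : t' ∈ ({b i, b' i} : Finset H) := hji ▸ ht'
          have hu'' : u' ∈ ({c i, c' i} : Finset H) := hli ▸ hu'
          obtain ⟨h1, h2⟩ := hW i t' ht'' t ht u hu u' hu'' e
          exact ⟨h1.symm, h2⟩
        · exact absurd e (hX j i l (Or.inr hli) t' ht' t ht u hu u' hu')
      · exact absurd e (hX j i l (Or.inl hji) t' ht' t ht u hu u' hu')

/-- **ENGINE ε₂'s model is Def. 5.1: a finite abelian group `H` hosts an STPP family of size pattern `(1,2,2)^k` (CKSU Def. 5.1, tree `IsSTPP`)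
iff some `b b' c c' : Fin k → H` satisfy `UniqueDiff122 b b' c c'`.**  An exhaustive NONE of the engine over its model (modulo the invariances
it quotients by: the two global translations, automorphisms, index relabelling) is therefore a NONE for the pattern; a FOUND is a family
(`({0}, {bᵢ, b'ᵢ}, {cᵢ, c'ᵢ})`). [cite: CohnKleinbergSzegedyUmans2005, Def. 5.1] -/
theorem exists_isSTPP_122_iff_uniqueDiff :
    (∃ A B C : Fin k → Finset H, IsSTPP A B C ∧ ∀ i, (A i).card = 1 ∧ (B i).card = 2 ∧ (C i).card = 2) ↔
      ∃ b b' c c' : Fin k → H, UniqueDiff122 b b' c c' := by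
  rw [exists_isSTPP_122_iff]
  constructor
  · rintro ⟨b, b', c, c', h⟩
    exact ⟨b, b', c, c', (uniqueDiff122_iff_pointPairs b b' c c').mpr h⟩
  · rintro ⟨b, b', c, c', h⟩
    exact ⟨b, b', c, c', (uniqueDiff122_iff_pointPairs b b' c c').mp h⟩

end Model

end Summit.MatrixMultiplication.OmegaCensus
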